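import Mathlib
import HarnessLib
import Literature.Analysis.FluidPDE.ParabolicComparison
import Summits.NavierStokesRegularity.NavierStokesRegularity.Theorems.PoloidalWindowDoorPoloidalWindowRigidityK2OfLrcSlope
import Summits.NavierStokesRegularity.NavierStokesRegularity.Theorems.PoloidalWindowDoorPoloidalWindowRigidityHotSplitRidgeReductions
import Summits.NavierStokesRegularity.NavierStokesRegularity.Theorems.PoloidalWindowDoorLrcModEntireTwistingTHPlaneOscillationProximity

/-!
# Item `LrcModEntire` (stmt-NavierStokesRegularity-20428), skeleton twist_split v6 — (TH) PROPAGATES TO EVERY PLANE, and the vorticity VANISHES on the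
# hot ridge of a pinned (TH) profile (part 1 of the cell form of the (TH) column under ⟨27893⟩; part 2 `…TwistingTHRidgeCells`)

Cell ns-regularity-ideate, LEAD ns-poloidal-K2-p3 g13 (`--supports stmt-NavierStokesRegularity-20428`; memo OSC-LIOUVILLE-g13 §5octies).  Companion of
`…TwistingTHRidgeThread` (p692231: under ⟨27893⟩ the (TH) column is the RIDGE THREAD) in the cell vocabulary of K2-p2's `…HotSplitCells` /
`…HotSplitRidgeReductions` / `…HotSplitRidgeKernels` (THICK column: HL3′ ⇐ C2a′ ∧ C2b′).  Pure analysis, class level: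

* `thBilinear_of_window` — **(TH) propagates.**  If `(∂₂v)_b = m(t,z)·(∂_b v)₂` (`b = 0,1`) on an open space-time window `W`, then by real-analyticity of the
  entries `(t,x) ↦ (∂_j v)_i(t,x)` (`…K2OfLrcSlope.analyticOnNhd_uncurry_fderiv_entry`) the BILINEAR form of (TH),
  `(∂₂v)_b(t,x)·(∂_c v)₂(t,x′) = (∂₂v)_c(t,x′)·(∂_b v)₂(t,x)` for all `x, x′` in a common horizontal plane, holds at EVERY time `t < 0` on EVERY plane
  (identity theorem on the connected set `{t < 0} × ℝ³ × ℝ²`, the last factor parametrising the horizontal offset `x′ − x`).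
* `fderiv_vert_eq_zero_of_horizCritical`, `curl_eq_zero_of_horizCritical` — hence at a horizontal-critical point `x` of `v₂(t,·)` on a plane where `v₂(t,·)` is
  not horizontally critical everywhere, `(∂₂v)_h(t,x) = 0` and (poloidality) `curl v(t,x) = 0`.
* `exists_horizGrad_ne_zero` — a plane on which `v₂` is not constant carries a point with `∇ₕv₂ ≠ 0`.
* `curl_eq_zero_on_hotSet` — so in the pinned class with the global bilinear (TH) identity and a non-flat thread plane the vorticity vanishes on the whole
  hot set `H = {y₂ = 0, v₂(−1,y) = v₂(−1,0)}` (R1 `hotSetClosedCritical`: `H` is critical): the THICK column's cell C2a («a vortex segment inside `H`») is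
  EMPTY in the (TH) column.

WHAT THIS IS NOT: not a claim about Navier–Stokes regularity and not a proof of the stub (bears_on LADDER-NS N0, item 20428 / crux 19708; both OPEN).
-/

noncomputable section

-- the summit and its single sub-problem share the name (CONVENTIONS §1), as in every Theorems file
set_option linter.dupNamespace false

namespace Summit.NavierStokesRegularity.NavierStokesRegularity.Theorems.PoloidalWindowDoorLrcModEntireTwistingTHRidgeVorticity

open Set Filter Topology Function Metric
open scoped RealInnerProductSpace InnerProductSpace Laplacian
open Literature.Analysis Literature.Analysis.FluidPDE
open Summit.NavierStokesRegularity.NavierStokesRegularity.Theorems.PoloidalWindowDoorPoloidalWindowRigidityK2OfLrcSlope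
open Summit.NavierStokesRegularity.NavierStokesRegularity.Theorems.PoloidalWindowDoorPoloidalWindowRigidityHotSplitRidgeReductions
open Summit.NavierStokesRegularity.NavierStokesRegularity.Theorems.PoloidalWindowDoorLrcModEntireTwistingTHPlaneOscillationProximity

variable {C : ℝ} {v : ℝ → EuclideanSpace ℝ (Fin 3) → EuclideanSpace ℝ (Fin 3)}

/-! ## 1. (TH) propagates: the bilinear identity on every plane at every time -/

/-- A horizontal offset has no height: `(a e₀ + a′ e₁)₂ = 0`. -/
theorem horizShift_apply_two (a a' : ℝ) :
    (a • EuclideanSpace.single (0 : Fin 3) (1 : ℝ) + a' • EuclideanSpace.single (1 : Fin 3) (1 : ℝ)) 2 = 0 := by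
  simp

/-- Two points of a common horizontal plane differ by the horizontal offset with coordinates `(x′₀ − x₀, x′₁ − x₁)`. -/
theorem add_horizShift_eq {x x' : EuclideanSpace ℝ (Fin 3)} (h : x 2 = x' 2) :
    x + ((x' 0 - x 0) • EuclideanSpace.single (0 : Fin 3) (1 : ℝ) + (x' 1 - x 1) • EuclideanSpace.single (1 : Fin 3) (1 : ℝ)) = x' := by
  ext i
  fin_cases i <;> simp [h]

/-- **(TH) PROPAGATES.**  If the (TH) structure `(∂₂v)_b = m(t,z)·(∂_b v)₂` (`b ≠ 2`) holds on an open non-empty space-time window `W ⊆ {t < 0}` of a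
Type-I Oseen-mild ancient profile, then its bilinear form holds for every `t < 0` and every pair of points of a common horizontal plane:
`(∂₂v)_b(t,x)·(∂_c v)₂(t,x′) = (∂₂v)_c(t,x′)·(∂_b v)₂(t,x)` (`b, c ≠ 2`).  Identity theorem for the real-analytic entries `(t,x) ↦ (∂_j v)_i(t,x)`. -/
theorem thBilinear_of_window (hrate : HasTypeITimeDecay C v)
    (hcont : ContinuousOn (uncurry v) (Iio (0 : ℝ) ×ˢ univ))
    (hmild : ∀ s t : ℝ, s < t → t < 0 → ∀ x,
      v t x = UnboundedOperators.heatExtension (v s) (t - s) x - oseenDuhamel 1 s v v t x)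
    {W : Set (ℝ × EuclideanSpace ℝ (Fin 3))} (hW : IsOpen W) (hWne : W.Nonempty) (hWs : W ⊆ Iio (0 : ℝ) ×ˢ univ)
    (hTH : ∃ m : ℝ → ℝ → ℝ, ∀ z ∈ W, ∀ b : Fin 3, b ≠ 2 →
      fderiv ℝ (v z.1) z.2 (EuclideanSpace.single 2 1) b = m z.1 (z.2 2) * fderiv ℝ (v z.1) z.2 (EuclideanSpace.single b 1) 2)
    {b c : Fin 3} (hb : b ≠ 2) (hc : c ≠ 2) :
    ∀ t < 0, ∀ x x' : EuclideanSpace ℝ (Fin 3), x 2 = x' 2 →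
      fderiv ℝ (v t) x (EuclideanSpace.single 2 1) b * fderiv ℝ (v t) x' (EuclideanSpace.single c 1) 2 =
        fderiv ℝ (v t) x' (EuclideanSpace.single 2 1) c * fderiv ℝ (v t) x (EuclideanSpace.single b 1) 2 := by
  intro t ht x x' hxx'
  obtain ⟨m, hm⟩ := hTH
  -- the real-analytic entries
  set D : Fin 3 → Fin 3 → ℝ × EuclideanSpace ℝ (Fin 3) → ℝ :=
    fun j i q => fderiv ℝ (v q.1) q.2 (EuclideanSpace.single j 1) i with hD
  have hDan : ∀ j i : Fin 3, ∀ q : ℝ × EuclideanSpace ℝ (Fin 3), q.1 < 0 → AnalyticAt ℝ (D j i) q := by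
    intro j i q hq
    exact analyticOnNhd_uncurry_fderiv_entry hrate hcont hmild j i q ⟨hq, mem_univ _⟩
  -- parameter space `P = ℝ × ℝ³ × ℝ²`: time, first point, horizontal offset of the second point (linear parametrisations)
  let Lt : (ℝ × EuclideanSpace ℝ (Fin 3) × (ℝ × ℝ)) →L[ℝ] ℝ := ContinuousLinearMap.fst ℝ ℝ (EuclideanSpace ℝ (Fin 3) × (ℝ × ℝ))
  let L₁ : (ℝ × EuclideanSpace ℝ (Fin 3) × (ℝ × ℝ)) →L[ℝ] EuclideanSpace ℝ (Fin 3) :=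
    (ContinuousLinearMap.fst ℝ (EuclideanSpace ℝ (Fin 3)) (ℝ × ℝ)).comp
      (ContinuousLinearMap.snd ℝ ℝ (EuclideanSpace ℝ (Fin 3) × (ℝ × ℝ)))
  let La : (ℝ × EuclideanSpace ℝ (Fin 3) × (ℝ × ℝ)) →L[ℝ] ℝ :=
    (ContinuousLinearMap.fst ℝ ℝ ℝ).comp ((ContinuousLinearMap.snd ℝ (EuclideanSpace ℝ (Fin 3)) (ℝ × ℝ)).comp
      (ContinuousLinearMap.snd ℝ ℝ (EuclideanSpace ℝ (Fin 3) × (ℝ × ℝ))))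
  let La' : (ℝ × EuclideanSpace ℝ (Fin 3) × (ℝ × ℝ)) →L[ℝ] ℝ :=
    (ContinuousLinearMap.snd ℝ ℝ ℝ).comp ((ContinuousLinearMap.snd ℝ (EuclideanSpace ℝ (Fin 3)) (ℝ × ℝ)).comp
      (ContinuousLinearMap.snd ℝ ℝ (EuclideanSpace ℝ (Fin 3) × (ℝ × ℝ))))
  let L₂ : (ℝ × EuclideanSpace ℝ (Fin 3) × (ℝ × ℝ)) →L[ℝ] EuclideanSpace ℝ (Fin 3) :=
    L₁ + La.smulRight (EuclideanSpace.single (0 : Fin 3) (1 : ℝ)) + La'.smulRight (EuclideanSpace.single (1 : Fin 3) (1 : ℝ))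
  have hLt : ∀ p, Lt p = p.1 := fun p => rfl
  have hL₁ : ∀ p, L₁ p = p.2.1 := fun p => rfl
  have hL₂ : ∀ p, L₂ p = p.2.1 + ((p.2.2.1 • EuclideanSpace.single (0 : Fin 3) (1 : ℝ)) +
      p.2.2.2 • EuclideanSpace.single (1 : Fin 3) (1 : ℝ)) := by
    intro p
    simp only [L₂, L₁, La, La', add_apply, ContinuousLinearMap.coe_comp, Function.comp_apply,
      ContinuousLinearMap.coe_fst', ContinuousLinearMap.coe_snd', ContinuousLinearMap.smulRight_apply, add_assoc]
  -- the defect of the bilinear identity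
  set G : ℝ × EuclideanSpace ℝ (Fin 3) × (ℝ × ℝ) → ℝ :=
    fun p => D 2 b (Lt p, L₁ p) * D c 2 (Lt p, L₂ p) - D 2 c (Lt p, L₂ p) * D b 2 (Lt p, L₁ p) with hG
  set U : Set (ℝ × EuclideanSpace ℝ (Fin 3) × (ℝ × ℝ)) := Iio (0 : ℝ) ×ˢ univ with hU
  have hGan : AnalyticOnNhd ℝ G U := by
    intro p hp
    have hp1 : (Lt p, L₁ p).1 < 0 := by
      rw [hU] at hp; exact hp.1
    have h1 : AnalyticAt ℝ (fun p : ℝ × EuclideanSpace ℝ (Fin 3) × (ℝ × ℝ) => D 2 b (Lt p, L₁ p)) p :=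
      AnalyticAt.comp₂ (hDan 2 b _ hp1) (Lt.analyticAt p) (L₁.analyticAt p)
    have h2 : AnalyticAt ℝ (fun p : ℝ × EuclideanSpace ℝ (Fin 3) × (ℝ × ℝ) => D c 2 (Lt p, L₂ p)) p :=
      AnalyticAt.comp₂ (hDan c 2 _ hp1) (Lt.analyticAt p) (L₂.analyticAt p)
    have h3 : AnalyticAt ℝ (fun p : ℝ × EuclideanSpace ℝ (Fin 3) × (ℝ × ℝ) => D 2 c (Lt p, L₂ p)) p :=
      AnalyticAt.comp₂ (hDan 2 c _ hp1) (Lt.analyticAt p) (L₂.analyticAt p)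
    have h4 : AnalyticAt ℝ (fun p : ℝ × EuclideanSpace ℝ (Fin 3) × (ℝ × ℝ) => D b 2 (Lt p, L₁ p)) p :=
      AnalyticAt.comp₂ (hDan b 2 _ hp1) (Lt.analyticAt p) (L₁.analyticAt p)
    rw [hG]
    exact (h1.mul h2).sub (h3.mul h4)
  have hUconn : IsPreconnected U := by
    rw [hU]; exact ((convex_Iio (0 : ℝ)).prod convex_univ).isPreconnected
  -- a window point and the vanishing of `G` near `(t₀, x₀, 0)`
  obtain ⟨z₀, hz₀⟩ := hWne
  have hz₀t : z₀.1 < 0 := (hWs hz₀).1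
  set p₀ : ℝ × EuclideanSpace ℝ (Fin 3) × (ℝ × ℝ) := (z₀.1, z₀.2, ((0 : ℝ), (0 : ℝ))) with hp₀
  have hp₀U : p₀ ∈ U := by
    rw [hU, hp₀]; exact ⟨hz₀t, mem_univ _⟩
  have hφ₁c : Continuous fun p : ℝ × EuclideanSpace ℝ (Fin 3) × (ℝ × ℝ) => ((Lt p, L₁ p) : ℝ × EuclideanSpace ℝ (Fin 3)) :=
    Lt.continuous.prodMk L₁.continuous
  have hφ₂c : Continuous fun p : ℝ × EuclideanSpace ℝ (Fin 3) × (ℝ × ℝ) => ((Lt p, L₂ p) : ℝ × EuclideanSpace ℝ (Fin 3)) :=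
    Lt.continuous.prodMk L₂.continuous
  have hVopen : IsOpen ({p : ℝ × EuclideanSpace ℝ (Fin 3) × (ℝ × ℝ) | (Lt p, L₁ p) ∈ W} ∩
      {p | (Lt p, L₂ p) ∈ W}) :=
    (hW.preimage hφ₁c).inter (hW.preimage hφ₂c)
  have hp₀V : p₀ ∈ ({p : ℝ × EuclideanSpace ℝ (Fin 3) × (ℝ × ℝ) | (Lt p, L₁ p) ∈ W} ∩ {p | (Lt p, L₂ p) ∈ W}) := by
    refine ⟨?_, ?_⟩
    · show (Lt p₀, L₁ p₀) ∈ W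
      rw [hLt, hL₁, hp₀]; simpa using hz₀
    · show (Lt p₀, L₂ p₀) ∈ W
      rw [hLt, hL₂, hp₀]; simpa using hz₀
  have hGev : G =ᶠ[𝓝 p₀] 0 := by
    filter_upwards [hVopen.mem_nhds hp₀V] with p hp
    obtain ⟨hp1, hp2⟩ := hp
    have e1 := hm _ hp1 b hb
    have e2 := hm _ hp2 c hc
    -- both points lie on the plane `z = (L₁ p)₂`
    have hz : (L₂ p) 2 = (L₁ p) 2 := by
      rw [hL₂, hL₁]; simp
    simp only at e1 e2
    rw [hz] at e2
    show D 2 b (Lt p, L₁ p) * D c 2 (Lt p, L₂ p) - D 2 c (Lt p, L₂ p) * D b 2 (Lt p, L₁ p) = 0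
    simp only [hD]
    rw [e1, e2]; ring
  have hEq := hGan.eqOn_zero_of_preconnected_of_eventuallyEq_zero hUconn hp₀U hGev
  -- evaluate at `(t, x, x′ − x)`
  set p₁ : ℝ × EuclideanSpace ℝ (Fin 3) × (ℝ × ℝ) := (t, x, (x' 0 - x 0, x' 1 - x 1)) with hp₁
  have hp₁U : p₁ ∈ U := by
    rw [hU, hp₁]; exact ⟨ht, mem_univ _⟩
  have h0 := hEq hp₁U
  have hg₁p : L₁ p₁ = x := by rw [hL₁, hp₁]
  have hg₂p : L₂ p₁ = x' := by
    rw [hL₂, hp₁]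
    exact add_horizShift_eq hxx'
  have hp₁1 : Lt p₁ = t := by rw [hLt, hp₁]
  have h0' : G p₁ = 0 := h0
  rw [hG] at h0'
  simp only at h0'
  rw [hg₁p, hg₂p, hp₁1] at h0'
  simpa [hD, sub_eq_zero] using h0'

/-! ## 2. Consequences at horizontal-critical points -/

/-- At a horizontal-critical point `x` of `v₂(t,·)` (`(∂₀v)₂ = (∂₁v)₂ = 0`) on a plane carrying a point `x′` with `(∂_c v)₂(t,x′) ≠ 0` (`c ≠ 2`), the global
bilinear (TH) identity forces `(∂₂v)_b(t,x) = 0` for `b ≠ 2`. -/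
theorem fderiv_vert_eq_zero_of_horizCritical {t : ℝ}
    (hglob : ∀ x x' : EuclideanSpace ℝ (Fin 3), x 2 = x' 2 → ∀ b c : Fin 3, b ≠ 2 → c ≠ 2 →
      fderiv ℝ (v t) x (EuclideanSpace.single 2 1) b * fderiv ℝ (v t) x' (EuclideanSpace.single c 1) 2 =
        fderiv ℝ (v t) x' (EuclideanSpace.single 2 1) c * fderiv ℝ (v t) x (EuclideanSpace.single b 1) 2)
    {x x' : EuclideanSpace ℝ (Fin 3)} (hxx' : x 2 = x' 2)
    (h0 : fderiv ℝ (v t) x (EuclideanSpace.single 0 1) 2 = 0) (h1 : fderiv ℝ (v t) x (EuclideanSpace.single 1 1) 2 = 0)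
    {c : Fin 3} (hc : c ≠ 2) (hx' : fderiv ℝ (v t) x' (EuclideanSpace.single c 1) 2 ≠ 0) :
    ∀ b : Fin 3, b ≠ 2 → fderiv ℝ (v t) x (EuclideanSpace.single 2 1) b = 0 := by
  intro b hb
  have hbz : fderiv ℝ (v t) x (EuclideanSpace.single b 1) 2 = 0 := by
    fin_cases b
    · simpa using h0
    · simpa using h1
    · exact absurd rfl hb
  have h := hglob x x' hxx' b c hb hc
  rw [hbz, mul_zero] at h
  rcases mul_eq_zero.1 h with h' | h'
  · exact h'
  · exact absurd h' hx'

/-- … and then, by poloidality `(curl v)₂ = 0`, the vorticity vanishes at `x`: `curl v(t) x = 0`. -/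
theorem curl_eq_zero_of_horizCritical {t : ℝ} {x : EuclideanSpace ℝ (Fin 3)}
    (hpol : curl (v t) x 2 = 0)
    (h0 : fderiv ℝ (v t) x (EuclideanSpace.single 0 1) 2 = 0) (h1 : fderiv ℝ (v t) x (EuclideanSpace.single 1 1) 2 = 0)
    (hvert : ∀ b : Fin 3, b ≠ 2 → fderiv ℝ (v t) x (EuclideanSpace.single 2 1) b = 0) :
    curl (v t) x = 0 := by
  have e0 : curl (v t) x 0 = fderiv ℝ (v t) x (EuclideanSpace.single 1 1) 2 - fderiv ℝ (v t) x (EuclideanSpace.single 2 1) 1 := by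
    simp [curl]
  have e1 : curl (v t) x 1 = fderiv ℝ (v t) x (EuclideanSpace.single 2 1) 0 - fderiv ℝ (v t) x (EuclideanSpace.single 0 1) 2 := by
    simp [curl]
  have hv0 := hvert 0 (by decide)
  have hv1 := hvert 1 (by decide)
  ext i
  fin_cases i
  · simp [e0, h1, hv1]
  · simp [e1, h0, hv0]
  · simpa using hpol

/-- A plane `{y₂ = 0}` on which the height component of a differentiable field is NOT constant carries a point with a non-zero horizontal partial
derivative of the height component. -/
theorem exists_horizGrad_ne_zero {V : EuclideanSpace ℝ (Fin 3) → EuclideanSpace ℝ (Fin 3)} (hV : Differentiable ℝ V)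
    (hnc : ∃ y : EuclideanSpace ℝ (Fin 3), y 2 = 0 ∧ V y 2 ≠ V 0 2) :
    ∃ x' : EuclideanSpace ℝ (Fin 3), x' 2 = 0 ∧ ∃ c : Fin 3, c ≠ 2 ∧ fderiv ℝ V x' (EuclideanSpace.single c 1) 2 ≠ 0 := by
  by_contra hcon
  push Not at hcon
  obtain ⟨y, hy2, hy⟩ := hnc
  have hV2 : Differentiable ℝ fun x : EuclideanSpace ℝ (Fin 3) => V x 2 :=
    fun x => (EuclideanSpace.proj (𝕜 := ℝ) (2 : Fin 3)).differentiableAt.comp x (hV x)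
  have hfd2 : ∀ x u : EuclideanSpace ℝ (Fin 3), fderiv ℝ (fun x => V x 2) x u = fderiv ℝ V x u 2 := by
    intro x u
    have h := (EuclideanSpace.proj (𝕜 := ℝ) (2 : Fin 3)).hasFDerivAt.comp x (hV x).hasFDerivAt
    rw [show (fun x => V x 2) = (EuclideanSpace.proj (𝕜 := ℝ) (2 : Fin 3)) ∘ V from rfl, h.fderiv]
    simp
  -- along the segment `σ ↦ σ y` (inside the plane) the derivative of `V₂` vanishes
  set g : ℝ → ℝ := fun σ => V ((0 : EuclideanSpace ℝ (Fin 3)) + σ • y) 2 with hg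
  have hgd : ∀ σ : ℝ, HasDerivAt g 0 σ := by
    intro σ
    have h := hasDerivAt_comp_line hV2 0 y σ
    have hplane : ((0 : EuclideanSpace ℝ (Fin 3)) + σ • y) 2 = 0 := by simp [hy2]
    have hzero : fderiv ℝ (fun x => V x 2) (0 + σ • y) y = 0 := by
      rw [hfd2, fderiv_apply_two_eq_sum, Fin.sum_univ_three, hy2, zero_mul, add_zero,
        hcon _ hplane 0 (by decide), hcon _ hplane 1 (by decide), mul_zero, mul_zero, add_zero]
    rw [hzero] at h
    exact h
  have hconst := is_const_of_deriv_eq_zero (fun σ => (hgd σ).differentiableAt) (fun σ => (hgd σ).deriv) 1 0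
  have : V y 2 = V 0 2 := by simpa [hg] using hconst
  exact hy this

/-! ## 3. The vorticity vanishes on the hot set of a pinned (TH) profile with a non-flat thread plane -/

/-- **`curl v(−1) = 0` on the hot set.**  Pinned class profile (K2-p2's `Pinned` package, unfolded), the global bilinear (TH) identity at `t = −1`, and a
non-flat thread plane (`∃ y, y₂ = 0, v₂(−1,y) ≠ v₂(−1,0)`) ⇒ the vorticity vanishes at every point of `H = {y₂ = 0, v₂(−1,y) = v₂(−1,0)}`
(R1 `hotSetClosedCritical`: `H` is critical; `exists_horizGrad_ne_zero`; `fderiv_vert_eq_zero_of_horizCritical`; `curl_eq_zero_of_horizCritical`). -/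
theorem curl_eq_zero_on_hotSet
    (hP : (Literature.Analysis.FluidPDE.HasTypeITimeDecay C v ∧
        ContinuousOn (Function.uncurry v) (Set.Iio (0 : ℝ) ×ˢ Set.univ) ∧
        (∀ s t : ℝ, s < t → t < 0 → ∀ x, v t x =
          Literature.Analysis.UnboundedOperators.heatExtension (v s) (t - s) x -
            Literature.Analysis.FluidPDE.oseenDuhamel 1 s v v t x) ∧
        (∀ t < 0, Literature.Analysis.FluidPDE.VectorCalculus.IsDivFree (v t)) ∧
        (∀ s < 0, ∀ y, ⟪Literature.Analysis.FluidPDE.curl (v s) y, EuclideanSpace.single 2 1⟫_ℝ = 0) ∧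
        v (-1) 0 2 ≠ 0 ∧ (∀ t < 0, ∀ x, Real.sqrt (-t) * |v t x 2| ≤ |v (-1) 0 2|) ∧
        (∀ h : EuclideanSpace ℝ (Fin 3), fderiv ℝ (v (-1)) 0 h 2 = 0) ∧
        (deriv (fun s => v s 0 2) (-1) = v (-1) 0 2 / 2 ∧ v (-1) 0 2 * (Δ (fun y => v (-1) y 2)) 0 ≤ 0)))
    (hglob : ∀ x x' : EuclideanSpace ℝ (Fin 3), x 2 = x' 2 → ∀ b c : Fin 3, b ≠ 2 → c ≠ 2 →
      fderiv ℝ (v (-1)) x (EuclideanSpace.single 2 1) b * fderiv ℝ (v (-1)) x' (EuclideanSpace.single c 1) 2 =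
        fderiv ℝ (v (-1)) x' (EuclideanSpace.single 2 1) c * fderiv ℝ (v (-1)) x (EuclideanSpace.single b 1) 2)
    (hnflat : ∃ y : EuclideanSpace ℝ (Fin 3), y 2 = 0 ∧ v (-1) y 2 ≠ v (-1) 0 2) :
    ∀ y ∈ {y : EuclideanSpace ℝ (Fin 3) | y 2 = 0 ∧ v (-1) y 2 = v (-1) 0 2}, curl (v (-1)) y = 0 := by
  intro y hy
  obtain ⟨_, hV2, _, hcurl2⟩ := slice_facts hP
  have hVd : Differentiable ℝ (v (-1)) := hV2.differentiable (by norm_num)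
  obtain ⟨_, hcrit⟩ := hotSetClosedCritical C v hP
  have hfd2 : ∀ x u : EuclideanSpace ℝ (Fin 3), fderiv ℝ (fun x => v (-1) x 2) x u = fderiv ℝ (v (-1)) x u 2 := by
    intro x u
    have h := (EuclideanSpace.proj (𝕜 := ℝ) (2 : Fin 3)).hasFDerivAt.comp x (hVd x).hasFDerivAt
    rw [show (fun x => v (-1) x 2) = (EuclideanSpace.proj (𝕜 := ℝ) (2 : Fin 3)) ∘ v (-1) from rfl, h.fderiv]
    simp
  have hcy := hcrit y hy
  have h0 : fderiv ℝ (v (-1)) y (EuclideanSpace.single 0 1) 2 = 0 := by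
    rw [← hfd2, hcy]; rfl
  have h1 : fderiv ℝ (v (-1)) y (EuclideanSpace.single 1 1) 2 = 0 := by
    rw [← hfd2, hcy]; rfl
  obtain ⟨x', hx'2, c, hc, hx'⟩ := exists_horizGrad_ne_zero hVd hnflat
  have hyx' : y 2 = x' 2 := by rw [hy.1, hx'2]
  have hvert := fderiv_vert_eq_zero_of_horizCritical (v := v) hglob hyx' h0 h1 hc hx'
  exact curl_eq_zero_of_horizCritical (hcurl2 y) h0 h1 hvert

end Summit.NavierStokesRegularity.NavierStokesRegularity.Theorems.PoloidalWindowDoorLrcModEntireTwistingTHRidgeVorticity
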